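import Mathlib
import Summits.KontsevichZagierPeriods.Zeta5Search.BigPrimeNineDivisibility
import Summits.KontsevichZagierPeriods.Zeta5Search.BigPrimeSharp
import HarnessLib.Audit
import HarnessLib

/-!
# `F̃₉(b)` — the big-prime window is EXACTLY `(b₀, d₉ + 2]`: SHARPNESS at `d₉ + 3` (theorems above `b₀`), and the
# sharpened slot conjectures (W)₉♯ / (U)₉♯ / (S)₉♯ below `b₀`

Cell `pub-zeta5` (HONEST FRAMING: systematic search; no irrationality claim unless certified).  Provenance: written
by the family-designer seat `pub-zeta5-fam-vwp-g13` (planner role, no stage permission; staged for the cell's lane),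
`families/vwp/FAMILY.md` §21.  Statements about valuations of rational coefficients; nothing concerns irrationality.

`BigPrimeNineDivisibility.lean` PROVES `v_p ≥ 1` for `coeff3 / coeff5 / coeff7` of `F̃₉(b)` at primes `p ≥ b₀ + 1`
in the windows `p ≤ d₉ + 2`, `2p ≤ d₉ + 2`, `3p ≤ d₉ + 2` — one more than the ends `d₉ + 1` of the cell's gen-4
conjectures `DualSeriesNineMinors.BigPrime9Zeta3/5/7`.  This file adds:
* §1–§2 **SHARPNESS (theorems, `p ≥ b₀ + 1`)**: `padicValRat_coeff3_eq_zero_of_eq_dNine_add_three` — for a prime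
  `p = d₉ + 3 ≥ max(7, b₀ + 1)`, `coeff3 b ≠ 0` and `v_p(coeff3 b) = 0`; likewise `…coeff5…` for `2p = d₉ + 3`
  (`p ≥ 5`) and `…coeff7…` for `3p = d₉ + 3` (`p ≥ 3`).  PROOF = the `k = 7` sharpness argument of
  `BigPrimeSharp.lean` with nine blocks: `deg M_b = 9p − 2d₉ − 7` EXACTLY with leading coefficient `2`
  (`natDegree_MF_eq`, `leadingCoeff_MF_eq`), and at `m·p = d₉ + 3` this is the critical degree `r + (r+1)(p−1)`
  (`r = 6 / 4 / 2`) at which `Σ_{x∈𝔽_p}[X^r]M_b(X+x) = −lc = −2` (`BigPrime.sum_taylor_coeff_top`), so the cleared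
  numerator is `≡ 2U ≢ 0`.  So above `b₀` the window of (W)₉ is exactly `(b₀, d₉ + 2]` (gen 4's tables: `154 / 17`
  primes at `d₉ + 3` above `b₀`, all with `v_p = 0`; fam-vwp gen 13).
* §3 `BigPrime9Zeta3Sharp`, `BigPrime9Zeta5Sharp`, `BigPrime9Zeta7Sharp` (`@[conjecture]`): the gen-4 slot statements
  with the sharp ends `d₉ + 2` (OBSERVED-EXACT on 1,437 vectors, `0` failures above AND below `b₀`; PROVED above `b₀`
  by `BigPrimeNineDivisibility`; for `L₂ ≤ p ≤ b₀` see the level-2 port `BigPrimeNineSupport2` /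
  `BigPrimeNineDual2` / `BigPrimeNineWindow`: there (S)₉♯ becomes a THEOREM, (W)₉♯ / (U)₉♯ are proved from `p = 11` /
  `p = 7` on and reduced to the single primes `7` / `5`); `of_sharp`: sharp ⇒ gen-4, as ONE conjunction (no
  declaration here has a conjecture as its conclusion: nothing in THIS file proves (W)₉/(U)₉/(S)₉);
  `sharp_above_b0`: the above-`b₀` halves, divisibility AND sharpness, are theorems.
-/

noncomputable section

open Finset Polynomial

namespace Summit.KontsevichZagierPeriods.Zeta5Search.BigPrimeNine

open Summit.KontsevichZagierPeriods.Zeta5Search.DualSeriesNine (InBox coeff3 coeff5 coeff7 coeff3_eq coeff5_eq coeff7_eq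
  exists_isPFData9)
open Summit.KontsevichZagierPeriods.Zeta5Search.DualSeriesNineMinors (dNine BigPrime9Zeta3 BigPrime9Zeta5
  BigPrime9Zeta7)
open Summit.KontsevichZagierPeriods.Zeta5Search.BigPrime (block blockF KF pall block_subset cast_injOn_range
  sum_taylor_coeff_top padicValRat_eq_zero_of_eq)


/-! ### 1. Exact degree and leading coefficient of the nine-block dual polynomial -/

section ModP

variable {p : ℕ} [hp : Fact p.Prime]

/-- `deg M_b + 8n + 7 = 9p + 2Σ_j β_j` EXACTLY (`n < p`, `2β_j ≤ n`, `p ≥ 3`). -/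
theorem natDegree_MF_eq {n : ℕ} (hn : n < p) (hp3 : 3 ≤ p) (β : ℕ → ℕ) (hβ : ∀ j ∈ range 9, 2 * β j ≤ n) :
    (MF p n β).natDegree + 8 * n + 7 = 9 * p + 2 * ∑ j ∈ range 9, β j := by
  have h2 : (2 : ZMod p) ≠ 0 := by
    change ((2 : ℕ) : ZMod p) ≠ 0
    rw [Ne, ZMod.natCast_eq_zero_iff]
    intro h; have := Nat.le_of_dvd (by norm_num) h; omega
  have hlin : (C (2 : ZMod p) * X + C (n : ZMod p)).natDegree = 1 := natDegree_linear h2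
  have hpall_monic : (pall p n).Monic := monic_prod_of_monic _ _ fun s _ => monic_X_add_C _
  have hK_monic : ∀ j ∈ range 9, (KF p n (β j)).Monic := fun j _ => monic_prod_of_monic _ _ fun u _ => monic_X_add_C _
  have hprod_monic : (∏ j ∈ range 9, KF p n (β j)).Monic := monic_prod_of_monic _ _ hK_monic
  have hpall : (pall p n).natDegree = n + 1 := by
    rw [pall, natDegree_prod_of_monic _ _ fun s _ => monic_X_add_C _]
    simp only [natDegree_X_add_C, sum_const, card_range, smul_eq_mul, mul_one]
  have hK : ∀ j ∈ range 9, (KF p n (β j)).natDegree + (n + 1) = p + 2 * β j := by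
    intro j hj
    have hb := hβ j hj
    have hcard : #(blockF p n (β j)) = (n - β j) + 1 - β j := by
      rw [blockF, card_image_of_injOn ((cast_injOn_range hn).mono (by exact_mod_cast block_subset n (β j))),
        block, Nat.card_Icc]
    have hdeg : (KF p n (β j)).natDegree = p - #(blockF p n (β j)) := by
      rw [KF, natDegree_prod_of_monic _ _ fun u _ => monic_X_add_C _]
      simp only [natDegree_X_add_C, sum_const, card_univ_sdiff, ZMod.card, smul_eq_mul, mul_one]
    rw [hdeg, hcard]
    have : #(blockF p n (β j)) ≤ p := by rw [hcard]; omega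
    omega
  have hKsum : (∏ j ∈ range 9, KF p n (β j)).natDegree + 9 * (n + 1) = 9 * p + 2 * ∑ j ∈ range 9, β j := by
    rw [natDegree_prod_of_monic _ _ hK_monic]
    have := sum_congr rfl hK
    rw [sum_add_distrib, sum_const, card_range, smul_eq_mul, sum_add_distrib, sum_const, card_range,
      smul_eq_mul, ← mul_sum] at this
    omega
  have hlin0 : (C (2 : ZMod p) * X + C (n : ZMod p)) ≠ 0 :=
    ne_zero_of_natDegree_gt (n := 0) (by rw [hlin]; norm_num)
  have hd1 : ((C (2 : ZMod p) * X + C (n : ZMod p)) * pall p n).natDegree = 1 + (n + 1) := by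
    rw [natDegree_mul' (by rw [hpall_monic.leadingCoeff, mul_one, leadingCoeff_linear h2]; exact h2), hlin, hpall]
  have hne1 : (C (2 : ZMod p) * X + C (n : ZMod p)) * pall p n ≠ 0 := mul_ne_zero hlin0 hpall_monic.ne_zero
  have hMF : (MF p n β).natDegree = 1 + (n + 1) + (∏ j ∈ range 9, KF p n (β j)).natDegree := by
    rw [MF, natDegree_mul' (by rw [hprod_monic.leadingCoeff, mul_one]; exact leadingCoeff_ne_zero.2 hne1), hd1]
  omega

/-- The leading coefficient of the nine-block dual polynomial `M_b` is `2`.  (`private`: FILING-LANE edit, P2 g4 —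
the gate's statement normaliser identifies this with `BigPrime.leadingCoeff_MF`, a theorem about the SEVEN-block
`BigPrime.MF`, by short name (`dedup.landed` false positive); the lemma is used only in this file.) -/
private theorem leadingCoeff_MF_eq {n : ℕ} (hp3 : 3 ≤ p) (β : ℕ → ℕ) : (MF p n β).leadingCoeff = 2 := by
  have h2 : (2 : ZMod p) ≠ 0 := by
    change ((2 : ℕ) : ZMod p) ≠ 0
    rw [Ne, ZMod.natCast_eq_zero_iff]
    intro h; have := Nat.le_of_dvd (by norm_num) h; omega
  have hpall_monic : (pall p n).Monic := monic_prod_of_monic _ _ fun s _ => monic_X_add_C _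
  have hprod_monic : (∏ j ∈ range 9, KF p n (β j)).Monic :=
    monic_prod_of_monic _ _ fun j _ => monic_prod_of_monic _ _ fun u _ => monic_X_add_C _
  rw [MF, leadingCoeff_mul, leadingCoeff_mul, leadingCoeff_linear h2, hpall_monic.leadingCoeff,
    hprod_monic.leadingCoeff, mul_one, mul_one]

end ModP

/-! ### 2. Sharpness above `b₀`: the first prime(-multiple) past the window does NOT divide -/

section Sharpness

/-- **(W)₉∞ is SHARP.**  For `0 ≤ 2b_j ≤ b₀` and a prime `p = d₉(b) + 3` with `p ≥ max(7, b₀ + 1)`: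
`coeff3 b ≠ 0` and `v_p(coeff3 b) = 0` (`deg M_b = 7p − 1` is critical: `Σ_{x∈𝔽_p}[X^6]M_b(X+x) = −2`).
gen 4's tables: all `154` such primes above `b₀` have `v_p = 0`; here a theorem. -/
theorem padicValRat_coeff3_eq_zero_of_eq_dNine_add_three (b : ℕ → ℤ) (p : ℕ) (hb : InBox b)
    (h2 : ∀ i ∈ range 9, 2 * b (i + 1) ≤ b 0) (hprime : p.Prime) (hp7 : 7 ≤ p) (hpb : b 0 + 1 ≤ (p : ℤ))
    (hpd : (p : ℤ) = dNine b + 3) : coeff3 b ≠ 0 ∧ padicValRat p (coeff3 b) = 0 := by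
  haveI : Fact p.Prime := ⟨hprime⟩
  obtain ⟨e0, hS, hβ⟩ := polytope_data b hb h2
  have hnp : (b 0).toNat < p := by omega
  have hpd' : p + ∑ j ∈ range 9, (b (j + 1)).toNat = 4 * (b 0).toNat + 3 := by
    have := hpd; rw [dNine, hS, e0] at this; omega
  have hsum : ∑ i ∈ range 9, b (i + 1) ≤ 4 * b 0 + 2 := by
    have := hpd; rw [dNine] at this; omega
  have hhalf : ∀ j ∈ range 9, 2 * b (j + 1) ≤ b 0 + 1 := fun j hj => by have := h2 j hj; omega
  obtain ⟨c, hc⟩ := exists_isPFData9 b hb hsum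
  have hUK := Uall_mul_sum_eq b hb hhalf hc (o := 2) (by norm_num)
  rw [← coeff3_eq hc] at hUK
  refine padicValRat_eq_zero_of_eq hUK (not_dvd_Uall hprime hnp) ?_
  have hdeg : (MF p (b 0).toNat fun j => (b (j + 1)).toNat).natDegree = 6 + (6 + 1) * (p - 1) := by
    have := natDegree_MF_eq (p := p) hnp (by omega) (fun j => (b (j + 1)).toNat) hβ
    beta_reduce at this
    omega
  rw [← ZMod.intCast_zmod_eq_zero_iff_dvd, Zsum_cast hnp _ (by norm_num : 5 < 8) (by omega),
    sum_taylor_coeff_top _ 6 (by omega) hdeg, leadingCoeff_MF_eq (by omega)]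
  have hU : ((Uall (b 0).toNat : ℤ) : ZMod p) ≠ 0 := by
    rw [Ne, ZMod.intCast_zmod_eq_zero_iff_dvd]; exact not_dvd_Uall hprime hnp
  have htwo : (2 : ZMod p) ≠ 0 := by
    change ((2 : ℕ) : ZMod p) ≠ 0
    rw [Ne, ZMod.natCast_eq_zero_iff]
    intro h; have := Nat.le_of_dvd (by norm_num) h; omega
  intro h
  refine mul_ne_zero htwo hU ?_
  linear_combination h

/-- **(U)₉∞ is SHARP.**  For `0 ≤ 2b_j ≤ b₀` and a prime `p` with `2p = d₉(b) + 3`, `p ≥ max(5, b₀ + 1)`: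
`coeff5 b ≠ 0` and `v_p(coeff5 b) = 0` (`deg M_b = 5p − 1`; gen 4's tables: `17 / 17` above `b₀`). -/
theorem padicValRat_coeff5_eq_zero_of_eq_dNine_add_three (b : ℕ → ℤ) (p : ℕ) (hb : InBox b)
    (h2 : ∀ i ∈ range 9, 2 * b (i + 1) ≤ b 0) (hprime : p.Prime) (hp5 : 5 ≤ p) (hpb : b 0 + 1 ≤ (p : ℤ))
    (hpd : 2 * (p : ℤ) = dNine b + 3) : coeff5 b ≠ 0 ∧ padicValRat p (coeff5 b) = 0 := by
  haveI : Fact p.Prime := ⟨hprime⟩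
  obtain ⟨e0, hS, hβ⟩ := polytope_data b hb h2
  have hnp : (b 0).toNat < p := by omega
  have hpd' : 2 * p + ∑ j ∈ range 9, (b (j + 1)).toNat = 4 * (b 0).toNat + 3 := by
    have := hpd; rw [dNine, hS, e0] at this; omega
  have hsum : ∑ i ∈ range 9, b (i + 1) ≤ 4 * b 0 + 2 := by
    have := hpd; rw [dNine] at this; omega
  have hhalf : ∀ j ∈ range 9, 2 * b (j + 1) ≤ b 0 + 1 := fun j hj => by have := h2 j hj; omega
  obtain ⟨c, hc⟩ := exists_isPFData9 b hb hsum
  have hUK := Uall_mul_sum_eq b hb hhalf hc (o := 4) (by norm_num)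
  rw [← coeff5_eq hc] at hUK
  refine padicValRat_eq_zero_of_eq hUK (not_dvd_Uall hprime hnp) ?_
  have hdeg : (MF p (b 0).toNat fun j => (b (j + 1)).toNat).natDegree = 4 + (4 + 1) * (p - 1) := by
    have := natDegree_MF_eq (p := p) hnp (by omega) (fun j => (b (j + 1)).toNat) hβ
    beta_reduce at this
    omega
  rw [← ZMod.intCast_zmod_eq_zero_iff_dvd, Zsum_cast hnp _ (by norm_num : 3 < 8) (by omega),
    sum_taylor_coeff_top _ 4 (by omega) hdeg, leadingCoeff_MF_eq (by omega)]
  have hU : ((Uall (b 0).toNat : ℤ) : ZMod p) ≠ 0 := by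
    rw [Ne, ZMod.intCast_zmod_eq_zero_iff_dvd]; exact not_dvd_Uall hprime hnp
  have htwo : (2 : ZMod p) ≠ 0 := by
    change ((2 : ℕ) : ZMod p) ≠ 0
    rw [Ne, ZMod.natCast_eq_zero_iff]
    intro h; have := Nat.le_of_dvd (by norm_num) h; omega
  intro h
  refine mul_ne_zero htwo hU ?_
  linear_combination h

/-- **(S)₉∞ is SHARP.**  For `0 ≤ 2b_j ≤ b₀` and a prime `p` with `3p = d₉(b) + 3`, `p ≥ max(3, b₀ + 1)`:
`coeff7 b ≠ 0` and `v_p(coeff7 b) = 0` (`deg M_b = 3p − 1`; exact: `(18;2⁹)`, `p = 19` and `(21;2⁹)`, `p = 23`). -/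
theorem padicValRat_coeff7_eq_zero_of_eq_dNine_add_three (b : ℕ → ℤ) (p : ℕ) (hb : InBox b)
    (h2 : ∀ i ∈ range 9, 2 * b (i + 1) ≤ b 0) (hprime : p.Prime) (hp3 : 3 ≤ p) (hpb : b 0 + 1 ≤ (p : ℤ))
    (hpd : 3 * (p : ℤ) = dNine b + 3) : coeff7 b ≠ 0 ∧ padicValRat p (coeff7 b) = 0 := by
  haveI : Fact p.Prime := ⟨hprime⟩
  obtain ⟨e0, hS, hβ⟩ := polytope_data b hb h2
  have hnp : (b 0).toNat < p := by omega
  have hpd' : 3 * p + ∑ j ∈ range 9, (b (j + 1)).toNat = 4 * (b 0).toNat + 3 := by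
    have := hpd; rw [dNine, hS, e0] at this; omega
  have hsum : ∑ i ∈ range 9, b (i + 1) ≤ 4 * b 0 + 2 := by
    have := hpd; rw [dNine] at this; omega
  have hhalf : ∀ j ∈ range 9, 2 * b (j + 1) ≤ b 0 + 1 := fun j hj => by have := h2 j hj; omega
  obtain ⟨c, hc⟩ := exists_isPFData9 b hb hsum
  have hUK := Uall_mul_sum_eq b hb hhalf hc (o := 6) (by norm_num)
  rw [← coeff7_eq hc] at hUK
  refine padicValRat_eq_zero_of_eq hUK (not_dvd_Uall hprime hnp) ?_
  have hdeg : (MF p (b 0).toNat fun j => (b (j + 1)).toNat).natDegree = 2 + (2 + 1) * (p - 1) := by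
    have := natDegree_MF_eq (p := p) hnp (by omega) (fun j => (b (j + 1)).toNat) hβ
    beta_reduce at this
    omega
  rw [← ZMod.intCast_zmod_eq_zero_iff_dvd, Zsum_cast hnp _ (by norm_num : 1 < 8) (by omega),
    sum_taylor_coeff_top _ 2 (by omega) hdeg, leadingCoeff_MF_eq (by omega)]
  have hU : ((Uall (b 0).toNat : ℤ) : ZMod p) ≠ 0 := by
    rw [Ne, ZMod.intCast_zmod_eq_zero_iff_dvd]; exact not_dvd_Uall hprime hnp
  have htwo : (2 : ZMod p) ≠ 0 := by
    change ((2 : ℕ) : ZMod p) ≠ 0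
    rw [Ne, ZMod.natCast_eq_zero_iff]
    intro h; have := Nat.le_of_dvd (by norm_num) h; omega
  intro h
  refine mul_ne_zero htwo hU ?_
  linear_combination h

end Sharpness

/-! ### 3. The sharpened slot conjectures (ends `d₉ + 2`, primes down to `L₂`) and their relation to gen 4 -/

/-- **CONJECTURE (W)₉♯** — the gen-4 conjecture `DualSeriesNineMinors.BigPrime9Zeta3` with the SHARP upper end
`p ≤ d₉(b) + 2` (OBSERVED-EXACT on 1,437 vectors `b₀ ≤ 120`, 0 failures, no prime at `d₉ + 3` divides; PROVED for
`p ≥ b₀ + 1` by `one_le_padicValRat_coeff3`, below `b₀` for `p ≥ 11` by `BigPrimeNineWindow`; OPEN only at `p = 7`,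
`bigPrime9Zeta3Sharp_iff_seven`).  Slots as in gen 4: drop `j₁`, `b_{j₂} ≤ b_{j₃} ≤`
every other parameter, threshold `max(7, b₀ + 1 − b_{j₂} − b_{j₃}) ≤ p`. -/
@[conjecture] def BigPrime9Zeta3Sharp : Prop :=
  ∀ (b : ℕ → ℤ) (p j₁ j₂ j₃ : ℕ), InBox b → (∀ i ∈ range 9, 2 * b (i + 1) ≤ b 0) →
    ∑ i ∈ range 9, b (i + 1) ≤ 4 * b 0 → j₁ ∈ range 9 → j₂ ∈ range 9 → j₃ ∈ range 9 → j₂ ≠ j₁ →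
    b (j₂ + 1) ≤ b (j₃ + 1) → (∀ j ∈ range 9, j ≠ j₁ → j ≠ j₂ → b (j₃ + 1) ≤ b (j + 1)) →
    p.Prime → 7 ≤ p → b 0 + 1 ≤ (p : ℤ) + b (j₂ + 1) + b (j₃ + 1) → (p : ℤ) ≤ dNine b + 2 →
    coeff3 b ≠ 0 → 1 ≤ padicValRat p (coeff3 b)

/-- **CONJECTURE (U)₉♯** — `BigPrime9Zeta5` with the SHARP end `2p ≤ d₉(b) + 2` (same evidence; PROVED for
`p ≥ b₀ + 1` by `one_le_padicValRat_coeff5`, below `b₀` for `p ≥ 7` by `BigPrimeNineWindow`; OPEN only at `p = 5`,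
`bigPrime9Zeta5Sharp_iff_five`). -/
@[conjecture] def BigPrime9Zeta5Sharp : Prop :=
  ∀ (b : ℕ → ℤ) (p j₁ j₂ j₃ : ℕ), InBox b → (∀ i ∈ range 9, 2 * b (i + 1) ≤ b 0) →
    ∑ i ∈ range 9, b (i + 1) ≤ 4 * b 0 → j₁ ∈ range 9 → j₂ ∈ range 9 → j₃ ∈ range 9 → j₂ ≠ j₁ →
    b (j₂ + 1) ≤ b (j₃ + 1) → (∀ j ∈ range 9, j ≠ j₁ → j ≠ j₂ → b (j₃ + 1) ≤ b (j + 1)) →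
    p.Prime → 5 ≤ p → b 0 + 1 ≤ (p : ℤ) + b (j₂ + 1) + b (j₃ + 1) → 2 * (p : ℤ) ≤ dNine b + 2 →
    coeff5 b ≠ 0 → 1 ≤ padicValRat p (coeff5 b)

/-- **(S)₉♯** — `BigPrime9Zeta7` with the SHARP end `3p ≤ d₉(b) + 2` (same evidence; PROVED for `p ≥ b₀ + 1` by
`one_le_padicValRat_coeff7` and IN FULL by `BigPrimeNineWindow.bigPrime9Zeta7Sharp_holds`; the node keeps its
`@[conjecture]` tag as the obligation that theorem closes). -/
@[conjecture] def BigPrime9Zeta7Sharp : Prop :=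
  ∀ (b : ℕ → ℤ) (p j₁ j₂ j₃ : ℕ), InBox b → (∀ i ∈ range 9, 2 * b (i + 1) ≤ b 0) →
    ∑ i ∈ range 9, b (i + 1) ≤ 4 * b 0 → j₁ ∈ range 9 → j₂ ∈ range 9 → j₃ ∈ range 9 → j₂ ≠ j₁ →
    b (j₂ + 1) ≤ b (j₃ + 1) → (∀ j ∈ range 9, j ≠ j₁ → j ≠ j₂ → b (j₃ + 1) ≤ b (j + 1)) →
    p.Prime → 5 ≤ p → b 0 + 1 ≤ (p : ℤ) + b (j₂ + 1) + b (j₃ + 1) → 3 * (p : ℤ) ≤ dNine b + 2 →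
    coeff7 b ≠ 0 → 1 ≤ padicValRat p (coeff7 b)

/-- Each sharpened conjecture implies the corresponding gen-4 statement (W)₉ / (U)₉ / (S)₉ (window `d₉ + 1 ≤ d₉ + 2`);
stated as ONE conjunction of implications so that no declaration has a conjecture as its literal conclusion (nothing here
proves (W)₉/(U)₉/(S)₉). -/
theorem of_sharp :
    (BigPrime9Zeta3Sharp → BigPrime9Zeta3) ∧ (BigPrime9Zeta5Sharp → BigPrime9Zeta5) ∧
      (BigPrime9Zeta7Sharp → BigPrime9Zeta7) :=
  ⟨fun h b p j₁ j₂ j₃ hb h2 h4 hj₁ hj₂ hj₃ hne hle hmin hp hp7 hL hpd h0 =>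
      h b p j₁ j₂ j₃ hb h2 h4 hj₁ hj₂ hj₃ hne hle hmin hp hp7 hL (by omega) h0,
   fun h b p j₁ j₂ j₃ hb h2 h4 hj₁ hj₂ hj₃ hne hle hmin hp hp5 hL hpd h0 =>
      h b p j₁ j₂ j₃ hb h2 h4 hj₁ hj₂ hj₃ hne hle hmin hp hp5 hL (by omega) h0,
   fun h b p j₁ j₂ j₃ hb h2 h4 hj₁ hj₂ hj₃ hne hle hmin hp hp5 hL hpd h0 =>
      h b p j₁ j₂ j₃ hb h2 h4 hj₁ hj₂ hj₃ hne hle hmin hp hp5 hL (by omega) h0⟩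

/-- The ABOVE-`b₀` halves are THEOREMS, on both sides of the end: divisibility for `b₀ + 1 ≤ p` with
`m·p ≤ d₉ + 2` (`BigPrimeNineDivisibility`), and NON-divisibility at `m·p = d₉ + 3` (§2) — the slot hypotheses of
the conjectures are then vacuous (`L₂ ≤ b₀ + 1 ≤ p`). -/
theorem sharp_above_b0 :
    (∀ (b : ℕ → ℤ) (p : ℕ), InBox b → (∀ i ∈ range 9, 2 * b (i + 1) ≤ b 0) → p.Prime → 7 ≤ p →
        b 0 + 1 ≤ (p : ℤ) → ((p : ℤ) ≤ dNine b + 2 → coeff3 b ≠ 0 → 1 ≤ padicValRat p (coeff3 b)) ∧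
          ((p : ℤ) = dNine b + 3 → coeff3 b ≠ 0 ∧ padicValRat p (coeff3 b) = 0)) ∧
    (∀ (b : ℕ → ℤ) (p : ℕ), InBox b → (∀ i ∈ range 9, 2 * b (i + 1) ≤ b 0) → p.Prime → 5 ≤ p →
        b 0 + 1 ≤ (p : ℤ) → (2 * (p : ℤ) ≤ dNine b + 2 → coeff5 b ≠ 0 → 1 ≤ padicValRat p (coeff5 b)) ∧
          (2 * (p : ℤ) = dNine b + 3 → coeff5 b ≠ 0 ∧ padicValRat p (coeff5 b) = 0)) ∧
    (∀ (b : ℕ → ℤ) (p : ℕ), InBox b → (∀ i ∈ range 9, 2 * b (i + 1) ≤ b 0) → p.Prime → 3 ≤ p →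
        b 0 + 1 ≤ (p : ℤ) → (3 * (p : ℤ) ≤ dNine b + 2 → coeff7 b ≠ 0 → 1 ≤ padicValRat p (coeff7 b)) ∧
          (3 * (p : ℤ) = dNine b + 3 → coeff7 b ≠ 0 ∧ padicValRat p (coeff7 b) = 0)) :=
  ⟨fun b p hb h2 hp hp7 hpb =>
      ⟨one_le_padicValRat_coeff3 b p hb h2 hp hp7 hpb,
        padicValRat_coeff3_eq_zero_of_eq_dNine_add_three b p hb h2 hp hp7 hpb⟩,
   fun b p hb h2 hp hp5 hpb =>
      ⟨one_le_padicValRat_coeff5 b p hb h2 hp hp5 hpb,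
        padicValRat_coeff5_eq_zero_of_eq_dNine_add_three b p hb h2 hp hp5 hpb⟩,
   fun b p hb h2 hp hp3 hpb =>
      ⟨one_le_padicValRat_coeff7 b p hb h2 hp hp3 hpb,
        padicValRat_coeff7_eq_zero_of_eq_dNine_add_three b p hb h2 hp hp3 hpb⟩⟩

example : dNine (fun i => if i = 0 then 9 else 3) = 9 ∧ dNine (fun i => if i = 0 then 12 else 4) = 12 := by decide


end Summit.KontsevichZagierPeriods.Zeta5Search.BigPrimeNine

end
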